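import Mathlib
import Summits.CriticalPhenomena.CardyFormulaZ2.Theorems.CardyMagicRigidityDefs
import Summits.CriticalPhenomena.CardyFormulaZ2.Theorems.CardyMagicRigidityNestingRigiditySmearedCentringZ2Cells
import Summits.CriticalPhenomena.CardyFormulaZ2.Theorems.CardyMagicRigidityNestingRigiditySmearedCentringZ2Dipole
import Summits.CriticalPhenomena.CardyFormulaZ2.Theorems.CardyMagicRigidityMagicFormulaTCentring
import Literature.Probability.Percolation.FKLoopNestingIntegrable
import HarnessLib

/-!
# Crux `NestingRigidity`, line `ring-cloud-tomography` (r5): SMEARED EXACT CENTRING on bond-`ℤ²` at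
# `p = 1/2` (keystone K3 `smearedCentring_zEns`, part 3/3 — the registered statement)

Crux `Summit.CriticalPhenomena.CardyFormulaZ2.Theses.CardyMagicRigidity.NestingRigidity`
(stmt-CriticalPhenomena-4835), line `ring-cloud-tomography`, keystone helper K3, proved EXACTLY as
registered:

**Theorem (`smearedCentring_zEns`).** For every admissible neutral density `f` (measurable,
`|f| ≤ C`, `f = 0` off `‖z‖ ≤ R`, `∫ f = 0`) and every mesh `δ > 0`,
`E_{1/2}[ Σ_{u loop of bondLoopConfig δ 0 ω} ∫_{W(u,·) ≠ 0} f ] = 0`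
— the bond-`ℤ²` twin of `MagicFormulaT.LineSketch.smearedCentring`: the twisted nesting transform of
critical bond percolation has NO linear term at ANY mesh, and hypothesis (L)'s untilted first-moment
identity of `uvDecoupling_of_tilted_moments` holds exactly on `ℤ²` as on `𝕋`.

Proof (the `𝕋` assembly of `…MagicFormulaTCentring` over the `ℤ²` inputs):
* CELL BRIDGE (`…SmearedCentringZ2Cells`): `θ_u = Σ_{F ∈ [-N,N]²} 𝟙[W(u, δ c_F) ≠ 0] λ_F` with the
  neutral cell charges `λ_F = ∫_{δ·cell F} f` of the scaled medial cells;
* DIPOLE DECOMPOSITION (§2, pure bookkeeping): for neutral `λ` and a base cell `F₀`,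
  `Σ_u θ_u = Σ_F λ_F (N_{F∖F₀} − N_{F₀∖F})`, `N_{x∖y} = #{u : W(u,x) ≠ 0, W(u,y) = 0}` — honest finite
  sums: a separating loop meets the segment between the two centres, and only finitely many loops meet
  a ball (`ncard_loops_meeting_le`); the counts are measurable and bounded, hence integrable (§1);
* DIPOLE SYMMETRY (`…SmearedCentringZ2Dipole`, `dipoleSymmetry_cellCenter_zEns`): `E N_{F∖F₀} =
  E N_{F₀∖F}` for all cells (point reflections of `ℤ²` + self-duality of `P_{1/2}`).

No definition (`sep[δ, ω, x, y]` is a local notation), no cited fact.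
-/

noncomputable section

open MeasureTheory Set Filter Metric
open scoped Real Topology BigOperators

namespace Summit.CriticalPhenomena.CardyFormulaZ2.Cruxes.NestingRigidity.RingCloudTomography

open Literature.Probability.RandomPlanarGeometry Literature.Probability.Percolation
  Literature.Probability.LatticeModels
open Summit.CriticalPhenomena.CardyFormulaZ2.Cruxes.MagicFormulaT.LineSketch
  (range_inter_segment_nonempty_of_wind_ne unbasedLoop_wind_eq_of_isPreconnected)

namespace SmearedCentringZ2

/-- The loops of `zEns` at mesh `δ` of the configuration `ω` winding around `x` and not around `y`
(local notation, not a definition). -/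
local notation3 (prettyPrint := false) "sep[" δ ", " ω ", " x ", " y "]" =>
  {u : UnbasedLoop ℂ | u ∈ (zEns.X δ ω).loops ∧ u.wind x ≠ 0 ∧ u.wind y = 0}

/-! ## §1 Separating loops: finitely many, measurable and integrable counts -/

/-- The separating loops are among the loops meeting the closed ball about `0` containing both
points (a loop with different winding numbers about `x` and `y` meets the segment `[x, y]`). -/
theorem sep_subset_meeting (δ : ℝ) (ω : zEns.Ω) {x y : ℂ} {ρ : ℝ} (hx : ‖x‖ ≤ ρ)
    (hy : ‖y‖ ≤ ρ) :
    sep[δ, ω, x, y] ⊆ {u | u ∈ (bondLoopConfig δ 0 ω).F 0 ∪ (bondLoopConfig δ 0 ω).F 1 ∧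
      (u.range ∩ closedBall (0 : ℂ) ρ).Nonempty} := by
  rintro u ⟨hu, hx0, hy0⟩
  refine ⟨hu, ?_⟩
  have hne : u.wind x ≠ u.wind y := by rw [hy0]; exact hx0
  obtain ⟨z, hzu, hzs⟩ := range_inter_segment_nonempty_of_wind_ne u hne
  exact ⟨z, hzu, (convex_closedBall (0 : ℂ) ρ).segment_subset (mem_closedBall_zero_iff.2 hx)
    (mem_closedBall_zero_iff.2 hy) hzs⟩

/-- **The separating loops are finitely many, uniformly in `ω`** (`δ > 0`). -/
theorem sep_finite_ncard_le {δ : ℝ} (hδ : 0 < δ) (ω : zEns.Ω) {x y : ℂ} {ρ : ℝ}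
    (hx : ‖x‖ ≤ ρ) (hy : ‖y‖ ≤ ρ) :
    (sep[δ, ω, x, y]).Finite ∧
      (sep[δ, ω, x, y]).ncard ≤ (finite_setOf_corner_norm_le hδ (ρ + |δ|)).toFinset.card := by
  obtain ⟨hfin, hle⟩ := ncard_loops_meeting_le hδ ρ ω
  have hsub := sep_subset_meeting δ ω hx hy
  exact ⟨hfin.subset hsub, (Set.ncard_le_ncard hsub hfin).trans hle⟩

/-- The count of separating loops is integrable (bounded by `sep_finite_ncard_le`, measurable by
`measurable_ncard_dipole`, probability law). -/
theorem integrable_ncard_sep {δ : ℝ} (hδ : 0 < δ) (x y : ℂ) :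
    Integrable (fun ω ↦ ((sep[δ, ω, x, y]).ncard : ℝ)) zEns.P := by
  haveI : IsProbabilityMeasure zEns.P :=
    inferInstanceAs (IsProbabilityMeasure (bondPercolation (zdGraph 2) half))
  refine Integrable.of_mem_Icc 0
    ((finite_setOf_corner_norm_le hδ (max ‖x‖ ‖y‖ + |δ|)).toFinset.card : ℝ)
    (measurable_ncard_dipole δ x y).aemeasurable
    (Eventually.of_forall fun ω ↦ ⟨Nat.cast_nonneg _, ?_⟩)
  exact_mod_cast (sep_finite_ncard_le hδ ω (le_max_left _ _) (le_max_right _ _)).2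

/-- **The dipole counts between cell centres are centred**: `E[N_{F∖F'} − N_{F'∖F}] = 0`
(`dipoleSymmetry_cellCenter_zEns`). -/
theorem integral_ncard_sep_sub_eq_zero {δ : ℝ} (hδ : 0 < δ) (F F' : ℤ × ℤ) :
    ∫ ω, (((sep[δ, ω, (δ : ℂ) * cellCenter F, (δ : ℂ) * cellCenter F']).ncard : ℝ) -
        ((sep[δ, ω, (δ : ℂ) * cellCenter F', (δ : ℂ) * cellCenter F]).ncard : ℝ)) ∂zEns.P = 0 := by
  rw [integral_sub (integrable_ncard_sep hδ _ _) (integrable_ncard_sep hδ _ _),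
    dipoleSymmetry_cellCenter_zEns δ F F', sub_self]

/-! ## §2 The phase sum as a combination of dipole counts -/

/-- One loop: a neutral phase is a combination of dipole indicators,
`Σ_x λ_x 𝟙[x ∈ u] = Σ_x λ_x (𝟙[x ∈ u, x₀ ∉ u] − 𝟙[x₀ ∈ u, x ∉ u])` when `Σ_x λ_x = 0`
(any index type, any centre map `c`). -/
theorem phase_eq_sum_dipole {ι : Type*} (u : UnbasedLoop ℂ) (S : Finset ι) (c : ι → ℂ)
    (lam : ι → ℝ) (x₀ : ι) (h0 : ∑ x ∈ S, lam x = 0) :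
    (∑ x ∈ S, if u.wind (c x) ≠ 0 then lam x else 0) =
      ∑ x ∈ S, lam x *
        ((if u.wind (c x) ≠ 0 ∧ u.wind (c x₀) = 0 then (1 : ℝ) else 0) -
          (if u.wind (c x₀) ≠ 0 ∧ u.wind (c x) = 0 then (1 : ℝ) else 0)) := by
  have key : ∀ x, (if u.wind (c x) ≠ 0 then lam x else 0) =
      lam x * ((if u.wind (c x) ≠ 0 ∧ u.wind (c x₀) = 0 then (1 : ℝ) else 0) -
        (if u.wind (c x₀) ≠ 0 ∧ u.wind (c x) = 0 then (1 : ℝ) else 0)) +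
        lam x * (if u.wind (c x₀) ≠ 0 then (1 : ℝ) else 0) := by
    intro x
    rcases eq_or_ne (u.wind (c x)) 0 with ha | ha <;>
      rcases eq_or_ne (u.wind (c x₀)) 0 with hb | hb <;> simp [ha, hb]
  simp_rw [key]
  rw [Finset.sum_add_distrib, ← Finset.sum_mul, h0, zero_mul, add_zero]

/-- **The neutral phase sum of a configuration of `zEns` (`δ > 0`) is a combination of dipole
counts**: `Σ_u θ_u = Σ_x λ_x (N_{x∖x₀} − N_{x₀∖x})`, an identity between finite sums (only the
finitely many loops meeting a ball containing the centres contribute). -/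
theorem finsum_phase_eq_sum_ncard {ι : Type*} {δ : ℝ} (hδ : 0 < δ) (ω : zEns.Ω)
    (S : Finset ι) (c : ι → ℂ) (lam : ι → ℝ) (x₀ : ι) (h0 : ∑ x ∈ S, lam x = 0) :
    (∑ᶠ u ∈ (zEns.X δ ω).loops, ∑ x ∈ S, if u.wind (c x) ≠ 0 then lam x else 0) =
      ∑ x ∈ S, lam x * (((sep[δ, ω, c x, c x₀]).ncard : ℝ) - ((sep[δ, ω, c x₀, c x]).ncard : ℝ)) := by
  classical
  -- a ball containing all the centres
  set ρ : ℝ := ∑ x ∈ insert x₀ S, ‖c x‖ with hρ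
  have hρx : ∀ x ∈ insert x₀ S, ‖c x‖ ≤ ρ := fun x hx ↦
    Finset.single_le_sum (f := fun x ↦ ‖c x‖) (fun _ _ ↦ norm_nonneg _) hx
  have hρ0 : ‖c x₀‖ ≤ ρ := hρx x₀ (Finset.mem_insert_self _ _)
  have hρS : ∀ x ∈ S, ‖c x‖ ≤ ρ := fun x hx ↦ hρx x (Finset.mem_insert_of_mem hx)
  -- the finite set of loops meeting it
  obtain ⟨hMfin, -⟩ := ncard_loops_meeting_le hδ ρ ω
  set M : Finset (UnbasedLoop ℂ) := hMfin.toFinset with hM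
  have hmemM : ∀ u, u ∈ (↑M : Set (UnbasedLoop ℂ)) ↔ u ∈ (zEns.X δ ω).loops ∧
      (u.range ∩ closedBall (0 : ℂ) ρ).Nonempty := fun u ↦ by
    rw [hM, Set.Finite.coe_toFinset, Set.mem_setOf_eq]
    rfl
  have hMsub : (↑M : Set (UnbasedLoop ℂ)) ⊆ (zEns.X δ ω).loops := fun u hu ↦ ((hmemM u).1 hu).1
  -- the phase sum is a sum over `M`
  have hsupp : (zEns.X δ ω).loops ∩ Function.support
      (fun u ↦ ∑ x ∈ S, if u.wind (c x) ≠ 0 then lam x else 0) ⊆ ↑M := by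
    rintro u ⟨hu, hne⟩
    rw [hmemM]
    refine ⟨hu, ?_⟩
    by_contra hdisj
    rw [Set.not_nonempty_iff_eq_empty] at hdisj
    have hdisj' : Disjoint (closedBall (0 : ℂ) ρ) u.range := by
      rw [Set.disjoint_iff_inter_eq_empty, Set.inter_comm, hdisj]
    -- the winding number is constant on the ball, so the phase is `𝟙 · Σ λ = 0`
    have hconst : ∀ x ∈ S, u.wind (c x) = u.wind (c x₀) := fun x hx ↦
      unbasedLoop_wind_eq_of_isPreconnected u (convex_closedBall (0 : ℂ) ρ).isPreconnected hdisj'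
        (mem_closedBall_zero_iff.2 (hρS x hx)) (mem_closedBall_zero_iff.2 hρ0)
    apply hne
    change (∑ x ∈ S, if u.wind (c x) ≠ 0 then lam x else 0) = 0
    have hsum : (∑ x ∈ S, if u.wind (c x) ≠ 0 then lam x else 0) =
        ∑ x ∈ S, if u.wind (c x₀) ≠ 0 then lam x else 0 :=
      Finset.sum_congr rfl fun x hx ↦ by rw [hconst x hx]
    rw [hsum]
    rcases eq_or_ne (u.wind (c x₀)) 0 with h | h
    · simp [h]
    · simp [h, h0]
  rw [finsum_mem_eq_sum_of_subset _ hsupp hMsub]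
  -- rewrite each phase as a combination of dipole indicators and swap the sums
  simp_rw [phase_eq_sum_dipole _ S c lam x₀ h0]
  rw [Finset.sum_comm]
  refine Finset.sum_congr rfl fun x hx ↦ ?_
  rw [← Finset.mul_sum, Finset.sum_sub_distrib]
  have hfilter : ∀ a b : ℂ, ‖a‖ ≤ ρ → ‖b‖ ≤ ρ →
      sep[δ, ω, a, b] = ↑(M.filter fun u ↦ u.wind a ≠ 0 ∧ u.wind b = 0) := by
    intro a b ha hb
    rw [Finset.coe_filter]
    ext u
    constructor
    · intro hu
      have huM : u ∈ (↑M : Set (UnbasedLoop ℂ)) := by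
        rw [hmemM]; exact sep_subset_meeting δ ω ha hb hu
      exact ⟨huM, hu.2⟩
    · rintro ⟨huM, hu⟩
      exact ⟨hMsub huM, hu⟩
  congr 2
  · rw [Finset.sum_boole, hfilter (c x) (c x₀) (hρS x hx) hρ0, Set.ncard_coe_finset]
  · rw [Finset.sum_boole, hfilter (c x₀) (c x) hρ0 (hρS x hx), Set.ncard_coe_finset]

/-! ## §3 The exact centring identities on bond-`ℤ²` -/

/-- **EXACT (dense) CENTRING on bond-`ℤ²` at `p = 1/2`**: for every mesh `δ > 0`, every finite set
`S` of medial cells and every NEUTRAL charge configuration `λ` on it (`Σ_F λ_F = 0`),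
`E_{1/2}[Σ_{u loop of X_δ ω} Σ_{F ∈ S : W(u, δ c_F) ≠ 0} λ_F] = 0`. -/
theorem integral_finsum_phase_eq_zero_zEns {δ : ℝ} (hδ : 0 < δ) (S : Finset (ℤ × ℤ))
    (lam : ℤ × ℤ → ℝ) (h0 : ∑ F ∈ S, lam F = 0) :
    ∫ ω, (∑ᶠ u ∈ (zEns.X δ ω).loops,
        ∑ F ∈ S, if u.wind ((δ : ℂ) * cellCenter F) ≠ 0 then lam F else 0) ∂zEns.P = 0 := by
  rcases S.eq_empty_or_nonempty with rfl | ⟨F₀, -⟩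
  · simp
  simp_rw [finsum_phase_eq_sum_ncard hδ _ S (fun F ↦ (δ : ℂ) * cellCenter F) lam F₀ h0]
  rw [integral_finsetSum]
  · refine Finset.sum_eq_zero fun F _ ↦ ?_
    rw [integral_const_mul, integral_ncard_sep_sub_eq_zero hδ F F₀, mul_zero]
  · intro F _
    exact ((integrable_ncard_sep hδ _ _).sub (integrable_ncard_sep hδ _ _)).const_mul (lam F)

/-- **SMEARED EXACT CENTRING on bond-`ℤ²` at mesh `δ`** (every admissible neutral density). -/
theorem integral_finsum_nestingPhase_eq_zero_zEns {f : ℂ → ℝ} {R C δ : ℝ} (hf : Measurable f)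
    (hC : ∀ z, |f z| ≤ C) (hR : ∀ z, R < ‖z‖ → f z = 0) (h0 : ∫ z, f z = 0) (hδ : 0 < δ) :
    ∫ ω, (∑ᶠ u ∈ (zEns.X δ ω).loops, ∫ z in {z : ℂ | u.wind z ≠ 0}, f z) ∂zEns.P = 0 := by
  have hN := two_mul_div_add_two_le_ceil R δ
  have hcongr : ∀ ω : zEns.Ω,
      (∑ᶠ u ∈ (zEns.X δ ω).loops, ∫ z in {z : ℂ | u.wind z ≠ 0}, f z) =
      ∑ᶠ u ∈ (zEns.X δ ω).loops, ∑ F ∈ Finset.Icc (-(⌈2 * R / δ + 2⌉₊ : ℤ)) ⌈2 * R / δ + 2⌉₊ ×ˢ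
        Finset.Icc (-(⌈2 * R / δ + 2⌉₊ : ℤ)) ⌈2 * R / δ + 2⌉₊,
        if u.wind ((δ : ℂ) * cellCenter F) ≠ 0 then ∫ z in scaledCell δ F, f z else 0 :=
    fun ω ↦ finsum_mem_congr rfl fun u hu ↦ nestingPhase_eq_sum_cells hf hC hR hδ hN hu
  simp_rw [hcongr]
  exact integral_finsum_phase_eq_zero_zEns hδ _ _ (sum_cellCharge_eq_zero hf hC hR h0 hδ hN)

end SmearedCentringZ2

open SmearedCentringZ2 in
/-- **Keystone K3 `smearedCentring_zEns` — SMEARED EXACT CENTRING on bond-`ℤ²` at `p = 1/2`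
(line `ring-cloud-tomography`, crux `NestingRigidity`).**  For every admissible neutral density `f`
(measurable, `|f| ≤ C`, `f = 0` off `‖z‖ ≤ R`, `∫ f = 0`) and every mesh `δ > 0`, the expected total
phase of the loops of critical bond percolation on `δℤ²` vanishes EXACTLY:
`E_{1/2}[Σ_{u ∈ loops(bondLoopConfig δ 0 ω)} ∫_{W(u,·) ≠ 0} f] = 0` — the twisted nesting transform
`t ↦ Λ^{ℤ²}_δ(t f)` has no linear term at any mesh, and the untilted first-moment identity of
hypothesis (L) holds exactly on `ℤ²` as on `𝕋`.  Cell bridge (`…SmearedCentringZ2Cells`) + dipole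
decomposition + dipole symmetry between all medial cells (point reflections of `ℤ²` and
self-duality of `P_{1/2}`, `…SmearedCentringZ2Dipole`). -/
theorem smearedCentring_zEns : ∀ (f : ℂ → ℝ) (R C δ : ℝ), Measurable f →
    (∀ z, |f z| ≤ C) → (∀ z, R < ‖z‖ → f z = 0) → ∫ z, f z = 0 → 0 < δ →
      ∫ ω, (∑ᶠ u ∈ (bondLoopConfig δ 0 ω).loops, ∫ z in {z : ℂ | u.wind z ≠ 0}, f z)
        ∂(bondPercolation (zdGraph 2) half) = 0 :=
  fun _ _ _ _ hf hC hR h0 hδ ↦ integral_finsum_nestingPhase_eq_zero_zEns hf hC hR h0 hδ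

end Summit.CriticalPhenomena.CardyFormulaZ2.Cruxes.NestingRigidity.RingCloudTomography

end
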